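import Mathlib
import Literature.NumberTheory.Sieve.ParityWave0MatomakiRadziwillHolds
import Literature.NumberTheory.LFunctions.LiouvilleSumClassicalBound
import HarnessLib

/-!
# Crux `MobiusLadder.LiouvilleOrthogonalTC0` (stmt-QuantumAdvantage-1393), line `Sketch`, skeleton v9:
stub `stub_alignedBlocks` (T1b) — `λ` has cancellation on almost all ALIGNED dyadic blocks

For every scale function `s` with `s j ≤ j`, `s j → ∞`, and every `η > 0`: eventually in `j`, the
`2^{j - s j}` aligned blocks `B_i = [2^j + i 2^{s j}, 2^j + (i+1) 2^{s j})` of length `2^{s j}`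
tiling `[2^j, 2^{j+1})` satisfy `Σ_i |Σ_{N ∈ B_i} λ(N)| ≤ η 2^j`.

Proof. Write `X = 2^j`, `H = 2^{s j}`, `M = 2^{j - s j}` (so `X + M H = 2X`) and take the window
length `h = 2^{⌊s j / 2⌋}` (`1 ≤ h ≤ H`, `h ≤ X`, `h² ≤ X`). The window-average hypothesis `hAvg`
(the landed neighbour `stub_windowAverage`) gives
`h Σ_i |Σ_{B_i} λ| ≤ 2 Σ_{x ∈ [X - h, 2X)} |Σ_{(x, x+h]} λ| + 2 h² M`.
The `h` windows starting below `X` contribute at most `h²`. For `x ∈ [X, 2X]` put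
`A = X⁻¹ Σ_{(X, 2X]} λ`; if `|h⁻¹ Σ_{(x,x+h]} λ - A| < ε` the window contributes at most
`h (ε + |A|)`, otherwise (a *bad* `x`) at most `h` (`alignedBlocks_window`), so that
`Σ_i |Σ_{B_i} λ| ≤ 2h + 2(X+1)(ε + |A|) + 2 · #bad + 2 h M` (`alignedBlocks_core`). Now, with
`ε = η/16`: `#bad = o(X)` along `X = 2^j` by the Matomäki–Radziwiłł theorem for `λ` (tree, PROVED:
`matomaki_radziwill_holds`, applied with the window function `X ↦ min X 2^{⌊s(log₂ X)/2⌋} → ∞`,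
`alignedBlocks_window_tendsto`); `|A| ≤ η/16` eventually by the prime number theorem for `λ`
(tree: `abs_sum_liouville_le_logPow`, `alignedBlocks_mean`); `2h ≤ (η/8) X` because `h² ≤ X` and
`h → ∞`; and `2 h M ≤ (η/8) X` because `X = h M 2^{s j - ⌊s j/2⌋}` with `s j - ⌊s j/2⌋ → ∞`.
In total `Σ_i |Σ_{B_i} λ| ≤ (7η/8) X ≤ η 2^j`.
-/

set_option linter.dupNamespace false -- D-0017: single-problem summit ⇒ `QuantumAdvantage.QuantumAdvantage` by design

noncomputable section

namespace Summit.QuantumAdvantage.QuantumAdvantage.Theorems.LiouvilleOrthogonalTC0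

open Filter Finset Asymptotics
open Literature.NumberTheory.LFunctions (abs_sum_liouville_le_logPow)
open Literature.NumberTheory.LFunctions.LiouvilleSum (abs_liouville_le_one)

/-- Trivial bound for a window of a `1`-bounded function: `|Σ_{n ∈ (x, x+h]} g n| ≤ h`. -/
theorem alignedBlocks_abs_window_le (g : ℕ → ℝ) (hg : ∀ n, |g n| ≤ 1) (x h : ℕ) :
    |∑ n ∈ Ioc x (x + h), g n| ≤ h :=
  calc |∑ n ∈ Ioc x (x + h), g n| ≤ ∑ n ∈ Ioc x (x + h), |g n| := abs_sum_le_sum_abs _ _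
    _ ≤ ∑ n ∈ Ioc x (x + h), (1 : ℝ) := sum_le_sum fun n _ => hg n
    _ = h := by rw [sum_const, nsmul_eq_mul, mul_one, Nat.card_Ioc, Nat.add_sub_cancel_left]

/-- One window against the mean `A`: if `|h⁻¹ Σ_{(x,x+h]} g - A| < ε` then
`|Σ_{(x,x+h]} g| ≤ h (ε + |A|)`, and otherwise (a *bad* `x`) `|Σ_{(x,x+h]} g| ≤ h`; in one line,
`|Σ_{(x,x+h]} g| ≤ h (ε + |A|) + h · 𝟙[bad]`. -/
theorem alignedBlocks_window (g : ℕ → ℝ) (hg : ∀ n, |g n| ≤ 1) (x h : ℕ) (ε A : ℝ)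
    (hε : 0 ≤ ε) :
    |∑ n ∈ Ioc x (x + h), g n|
      ≤ h * (ε + |A|)
        + h * (if ε ≤ |(h : ℝ)⁻¹ * ∑ n ∈ Ioc x (x + h), g n - A| then 1 else 0) := by
  have hW := alignedBlocks_abs_window_le g hg x h
  have hh0 : (0 : ℝ) ≤ h := Nat.cast_nonneg h
  have hεA : 0 ≤ (h : ℝ) * (ε + |A|) := mul_nonneg hh0 (add_nonneg hε (abs_nonneg A))
  split_ifs with hbad
  · linarith
  · push Not at hbad
    rcases Nat.eq_zero_or_pos h with rfl | hpos
    · simp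
    · have hhr : (0 : ℝ) < h := by exact_mod_cast hpos
      have hkey : |(h : ℝ)⁻¹ * ∑ n ∈ Ioc x (x + h), g n| ≤ ε + |A| := by
        have := abs_sub_abs_le_abs_sub ((h : ℝ)⁻¹ * ∑ n ∈ Ioc x (x + h), g n) A
        linarith
      have hWeq : |∑ n ∈ Ioc x (x + h), g n| = (h : ℝ) * |(h : ℝ)⁻¹ * ∑ n ∈ Ioc x (x + h), g n| := by
        rw [abs_mul, abs_inv, Nat.abs_cast, ← mul_assoc, mul_inv_cancel₀ hhr.ne', one_mul]
      rw [hWeq, mul_zero, add_zero]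
      exact mul_le_mul_of_nonneg_left hkey hh0

/-- Summing `alignedBlocks_window` over `x ∈ [X, 2X]`:
`Σ_{x ∈ [X, 2X]} |Σ_{(x,x+h]} g| ≤ (X+1) h (ε + |A|) + h · #{bad x ∈ [X, 2X]}`. -/
theorem alignedBlocks_sumIcc (g : ℕ → ℝ) (hg : ∀ n, |g n| ≤ 1) (X h : ℕ) (ε A : ℝ)
    (hε : 0 ≤ ε) :
    ∑ x ∈ Icc X (2 * X), |∑ n ∈ Ioc x (x + h), g n|
      ≤ ((X : ℝ) + 1) * h * (ε + |A|)
        + h * (#{x ∈ Icc X (2 * X) | ε ≤ |(h : ℝ)⁻¹ * ∑ n ∈ Ioc x (x + h), g n - A|} : ℝ) := by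
  have hsum := Finset.sum_le_sum fun x (_ : x ∈ Icc X (2 * X)) =>
    alignedBlocks_window g hg x h ε A hε
  rw [Finset.sum_add_distrib, Finset.sum_const, Nat.card_Icc, nsmul_eq_mul, ← Finset.mul_sum,
    Finset.sum_boole] at hsum
  have hc : ((2 * X + 1 - X : ℕ) : ℝ) = (X : ℝ) + 1 := by
    rw [show 2 * X + 1 - X = X + 1 by omega]
    push_cast
    ring
  rw [hc] at hsum
  calc ∑ x ∈ Icc X (2 * X), |∑ n ∈ Ioc x (x + h), g n|
      ≤ ((X : ℝ) + 1) * (h * (ε + |A|))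
        + h * (#{x ∈ Icc X (2 * X) | ε ≤ |(h : ℝ)⁻¹ * ∑ n ∈ Ioc x (x + h), g n - A|} : ℝ) :=
        hsum
    _ = _ := by ring

/-- **Deterministic core.** For a `1`-bounded `g`, block parameters `1 ≤ h ≤ H`, `h ≤ X`,
`X + M H = 2X`, any `ε ≥ 0` and any real `A` (the mean), the window average `hAvg` yields
`Σ_{i<M} |Σ_{[X+iH, X+(i+1)H)} g| ≤ 2h + 2(X+1)(ε + |A|) + 2 · #{bad x ∈ [X, 2X]} + 2 h M`,
where `x` is *bad* when `ε ≤ |h⁻¹ Σ_{(x,x+h]} g - A|`. -/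
theorem alignedBlocks_core
    (hAvg : ∀ (f : ℕ → ℝ), (∀ N, |f N| ≤ 1) → ∀ (X H h M : ℕ), 1 ≤ h → h ≤ H → h ≤ X →
      (h : ℝ) * ∑ i ∈ Finset.range M, |∑ N ∈ Finset.Ico (X + i * H) (X + (i + 1) * H), f N|
        ≤ 2 * ∑ x ∈ Finset.Ico (X - h) (X + M * H), |∑ N ∈ Finset.Ioc x (x + h), f N|
          + 2 * (h : ℝ) ^ 2 * M)
    (g : ℕ → ℝ) (hg : ∀ n, |g n| ≤ 1) (X H h M : ℕ) (hh : 1 ≤ h) (hhH : h ≤ H) (hhX : h ≤ X)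
    (hXMH : X + M * H = 2 * X) (ε A : ℝ) (hε : 0 ≤ ε) :
    ∑ i ∈ range M, |∑ N ∈ Ico (X + i * H) (X + (i + 1) * H), g N|
      ≤ 2 * h + 2 * ((X : ℝ) + 1) * (ε + |A|)
        + 2 * (#{x ∈ Icc X (2 * X) | ε ≤ |(h : ℝ)⁻¹ * ∑ n ∈ Ioc x (x + h), g n - A|} : ℝ)
        + 2 * h * M := by
  have h1 := hAvg g hg X H h M hh hhH hhX
  rw [hXMH, ← Finset.sum_Ico_consecutive _ (Nat.sub_le X h) (by omega : X ≤ 2 * X)] at h1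
  -- the `h` windows starting below `X`
  have hleft : ∑ x ∈ Ico (X - h) X, |∑ n ∈ Ioc x (x + h), g n| ≤ (h : ℝ) * h := by
    calc ∑ x ∈ Ico (X - h) X, |∑ n ∈ Ioc x (x + h), g n|
        ≤ ∑ x ∈ Ico (X - h) X, (h : ℝ) :=
          sum_le_sum fun x _ => alignedBlocks_abs_window_le g hg x h
      _ = (h : ℝ) * h := by
          rw [sum_const, nsmul_eq_mul, Nat.card_Ico, Nat.sub_sub_self hhX]
  -- the windows starting in `[X, 2X)`, extended to `[X, 2X]`
  have hright : ∑ x ∈ Ico X (2 * X), |∑ n ∈ Ioc x (x + h), g n|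
      ≤ ∑ x ∈ Icc X (2 * X), |∑ n ∈ Ioc x (x + h), g n| :=
    sum_le_sum_of_subset_of_nonneg Ico_subset_Icc_self fun x _ _ => abs_nonneg _
  have hIcc := alignedBlocks_sumIcc g hg X h ε A hε
  -- divide by `h`
  have hpos : (0 : ℝ) < h := by exact_mod_cast hh
  refine le_of_mul_le_mul_left ?_ hpos
  have hexp : (h : ℝ) * (2 * h + 2 * ((X : ℝ) + 1) * (ε + |A|)
      + 2 * (#{x ∈ Icc X (2 * X) | ε ≤ |(h : ℝ)⁻¹ * ∑ n ∈ Ioc x (x + h), g n - A|} : ℝ)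
      + 2 * h * M)
      = 2 * ((h : ℝ) * h + (((X : ℝ) + 1) * h * (ε + |A|)
          + h * (#{x ∈ Icc X (2 * X) | ε ≤ |(h : ℝ)⁻¹ * ∑ n ∈ Ioc x (x + h), g n - A|} : ℝ)))
        + 2 * (h : ℝ) ^ 2 * M := by
    ring
  rw [hexp]
  linarith [h1, hleft, hright, hIcc]

/-- The window function `X ↦ min X 2^{⌊s(⌊log₂ X⌋)/2⌋}` fed into the Matomäki–Radziwiłł theorem
tends to infinity when `s` does. -/
theorem alignedBlocks_window_tendsto (s : ℕ → ℕ) (hs' : Tendsto s atTop atTop) :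
    Tendsto (fun X : ℕ => min X (2 ^ (s (Nat.log 2 X) / 2))) atTop atTop := by
  rw [Filter.tendsto_atTop_atTop]
  intro b
  obtain ⟨j₀, hj₀⟩ := Filter.tendsto_atTop_atTop.mp hs' (2 * b)
  refine ⟨max b (2 ^ j₀), fun X hX => ?_⟩
  have hXb : b ≤ X := le_of_max_le_left hX
  have hX2 : 2 ^ j₀ ≤ X := le_of_max_le_right hX
  have hlog : j₀ ≤ Nat.log 2 X := Nat.le_log_of_pow_le one_lt_two hX2
  have hsj : 2 * b ≤ s (Nat.log 2 X) := hj₀ _ hlog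
  refine le_min hXb ?_
  calc b ≤ 2 ^ b := Nat.lt_two_pow_self.le
    _ ≤ 2 ^ (s (Nat.log 2 X) / 2) := Nat.pow_le_pow_right two_pos (by omega)

/-- **The mean of `λ` on `(X, 2X]` tends to `0`** (prime number theorem for `λ`, tree:
`abs_sum_liouville_le_logPow` with `A = 1`): for every `δ > 0`, eventually in `X`,
`|X⁻¹ Σ_{n ∈ (X, 2X]} λ(n)| ≤ δ`. -/
theorem alignedBlocks_mean (δ : ℝ) (hδ : 0 < δ) :
    ∀ᶠ X : ℕ in atTop,
      |(X : ℝ)⁻¹ * ∑ n ∈ Ioc X (2 * X), (ArithmeticFunction.liouville n : ℝ)| ≤ δ := by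
  obtain ⟨C, hC⟩ := abs_sum_liouville_le_logPow 1
  have hC0 : 0 ≤ C := by
    have h2 := hC 2 le_rfl
    rw [Real.rpow_one] at h2
    have hl : 0 < Real.log 2 := Real.log_pos one_lt_two
    have h0 : (0 : ℝ) ≤ C * 2 / Real.log 2 := (abs_nonneg _).trans h2
    by_contra hneg
    push Not at hneg
    have : C * 2 / Real.log 2 < 0 := div_neg_of_neg_of_pos (by linarith) hl
    linarith
  filter_upwards [eventually_ge_atTop 2,
    tendsto_natCast_atTop_atTop.eventually_ge_atTop (Real.exp (3 * C / δ))] with X hX2 hXexp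
  have hXr : (2 : ℝ) ≤ X := by exact_mod_cast hX2
  have hX0 : (0 : ℝ) < X := by linarith
  have hlogX : 0 < Real.log X := Real.log_pos (by linarith)
  have hlog2X : Real.log X ≤ Real.log ((2 * X : ℕ) : ℝ) :=
    Real.log_le_log hX0 (by push_cast; linarith)
  have hA := hC (X : ℝ) hXr
  have hB := hC ((2 * X : ℕ) : ℝ) (by push_cast; linarith)
  rw [Nat.floor_natCast, Real.rpow_one] at hA hB
  have hsplit := Finset.sum_Ioc_consecutive (fun n => (ArithmeticFunction.liouville n : ℝ))
    (Nat.zero_le X) (by omega : X ≤ 2 * X)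
  have hS : |∑ n ∈ Ioc X (2 * X), (ArithmeticFunction.liouville n : ℝ)|
      ≤ C * ((2 * X : ℕ) : ℝ) / Real.log ((2 * X : ℕ) : ℝ) + C * X / Real.log X := by
    rw [eq_sub_of_add_eq' hsplit]
    exact (abs_sub _ _).trans (add_le_add hB hA)
  have hB' : C * ((2 * X : ℕ) : ℝ) / Real.log ((2 * X : ℕ) : ℝ)
      ≤ C * ((2 * X : ℕ) : ℝ) / Real.log X :=
    div_le_div_of_nonneg_left (by positivity) hlogX hlog2X
  have hlogge : 3 * C / δ ≤ Real.log X := by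
    have := Real.log_le_log (Real.exp_pos _) hXexp
    rwa [Real.log_exp] at this
  rw [abs_mul, abs_inv, Nat.abs_cast, inv_mul_le_iff₀ hX0]
  have h3 : 3 * C ≤ Real.log X * δ := by rwa [div_le_iff₀ hδ] at hlogge
  have h3X : (X : ℝ) * (3 * C) ≤ (X : ℝ) * (Real.log X * δ) := mul_le_mul_of_nonneg_left h3 hX0.le
  have key : C * ((2 * X : ℕ) : ℝ) / Real.log X + C * X / Real.log X ≤ X * δ := by
    rw [← add_div, div_le_iff₀ hlogX]
    push_cast
    linarith
  linarith

/-- **Few bad windows** (the Matomäki–Radziwiłł theorem for `λ`, tree: `matomaki_radziwill_holds`):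
for a window length `w(X) → ∞` with `w(X) ≤ X` and `ε > 0`, the number of `x ∈ [X, 2X]` with
`ε ≤ |w(X)⁻¹ Σ_{(x, x+w(X)]} λ - X⁻¹ Σ_{(X, 2X]} λ|` is `o(X)`. Stated through any real arithmetic
function `F` agreeing with `λ` pointwise (applied with the coercion of `ArithmeticFunction.liouville`). -/
theorem alignedBlocks_badCount (F : ArithmeticFunction ℝ) (hFm : F.IsMultiplicative)
    (hF : ∀ n : ℕ, F n = (ArithmeticFunction.liouville n : ℝ)) (w : ℕ → ℕ)
    (hw : Tendsto w atTop atTop) (hwX : ∀ X, w X ≤ X) (ε : ℝ) (hε : 0 < ε) :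
    (fun X : ℕ => (#{x ∈ Icc X (2 * X) | ε ≤ |(w X : ℝ)⁻¹
        * ∑ n ∈ Ioc x (x + w X), (ArithmeticFunction.liouville n : ℝ)
          - (X : ℝ)⁻¹ * ∑ n ∈ Ioc X (2 * X), (ArithmeticFunction.liouville n : ℝ)|} : ℝ))
      =o[atTop] fun X => (X : ℝ) := by
  have hF1 : ∀ n : ℕ, |F n| ≤ 1 := fun n => by
    rw [hF]
    exact abs_liouville_le_one n
  have hMR := Literature.NumberTheory.Sieve.matomaki_radziwill_holds F hFm hF1 w hw hwX ε hε
  simp only [hF] at hMR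
  exact hMR

/-- **Stub `stub_alignedBlocks` (line `Sketch`, v9, T1b) — `λ` has cancellation on almost all
ALIGNED dyadic blocks.** For every scale function `s` with `s j ≤ j`, `s j → ∞`, and every `η > 0`:
eventually in `j`, the `2^{j - s j}` aligned blocks of length `2^{s j}` tiling `[2^j, 2^{j+1})`
satisfy `Σ_i |Σ_{B_i} λ| ≤ η 2^j`. From the Matomäki–Radziwiłł theorem for `λ` (tree, PROVED:
`matomaki_radziwill_holds`, windows `(x, x+h]`, `h = h(X) → ∞`) with `h(X) = 2^{⌊s(log₂ X)/2⌋}`,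
the window average `hAvg` (`stub_windowAverage`), the prime number theorem for `λ` (tree:
`abs_sum_liouville_le_logPow`) for the mean on `(X, 2X]`, and `h² ≤ 2^j`,
`h M 2^{s j - ⌊s j/2⌋} = 2^j`. -/
theorem stub_alignedBlocks
    (hAvg : ∀ (f : ℕ → ℝ), (∀ N, |f N| ≤ 1) → ∀ (X H h M : ℕ), 1 ≤ h → h ≤ H → h ≤ X →
      (h : ℝ) * ∑ i ∈ Finset.range M, |∑ N ∈ Finset.Ico (X + i * H) (X + (i + 1) * H), f N|
        ≤ 2 * ∑ x ∈ Finset.Ico (X - h) (X + M * H), |∑ N ∈ Finset.Ioc x (x + h), f N|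
          + 2 * (h : ℝ) ^ 2 * M)
    (s : ℕ → ℕ) (hs : ∀ j, s j ≤ j) (hs' : Tendsto s atTop atTop) (η : ℝ) (hη : 0 < η) :
    ∀ᶠ j : ℕ in atTop,
      (∑ i ∈ Finset.range (2 ^ (j - s j)),
        |∑ N ∈ Finset.Ico (2 ^ j + i * 2 ^ s j) (2 ^ j + (i + 1) * 2 ^ s j),
          (ArithmeticFunction.liouville N : ℝ)|) ≤ η * 2 ^ j := by
  have hε : (0 : ℝ) < η / 16 := by positivity
  -- Matomäki–Radziwiłł for `λ` with the window function `X ↦ min X 2^{⌊s(log₂ X)/2⌋}`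
  have hMR := alignedBlocks_badCount
    ((ArithmeticFunction.liouville : ArithmeticFunction ℤ) : ArithmeticFunction ℝ)
    ArithmeticFunction.isMultiplicative_liouville.intCast (fun _ => rfl)
    (fun X => min X (2 ^ (s (Nat.log 2 X) / 2))) (alignedBlocks_window_tendsto s hs')
    (fun X => min_le_left _ _) (η / 16) hε
  have h2pow : Tendsto (fun n : ℕ => 2 ^ n) atTop atTop :=
    tendsto_pow_atTop_atTop_of_one_lt one_lt_two
  have hbad := h2pow.eventually (hMR.def hε)
  have hmean : ∀ᶠ j : ℕ in atTop, |((2 ^ j : ℕ) : ℝ)⁻¹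
      * ∑ n ∈ Ioc (2 ^ j) (2 * 2 ^ j), (ArithmeticFunction.liouville n : ℝ)| ≤ η / 16 :=
    h2pow.eventually (alignedBlocks_mean (η / 16) hε)
  -- `⌊s j / 2⌋ → ∞` and `s j - ⌊s j / 2⌋ → ∞`
  have hdiv2 : Tendsto (fun j => s j / 2) atTop atTop := by
    rw [Filter.tendsto_atTop_atTop]
    intro b
    obtain ⟨J, hJ⟩ := Filter.tendsto_atTop_atTop.mp hs' (2 * b)
    exact ⟨J, fun j hj => by have := hJ j hj; omega⟩
  have hsub : Tendsto (fun j => s j - s j / 2) atTop atTop :=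
    tendsto_atTop_mono (fun j => Nat.le_sub_of_add_le (by omega)) hdiv2
  have hw : ∀ᶠ j : ℕ in atTop, 16 / η ≤ ((2 ^ (s j / 2) : ℕ) : ℝ) :=
    (tendsto_natCast_atTop_atTop.comp (h2pow.comp hdiv2)).eventually_ge_atTop (16 / η)
  have ht : ∀ᶠ j : ℕ in atTop, 16 / η ≤ ((2 ^ (s j - s j / 2) : ℕ) : ℝ) :=
    (tendsto_natCast_atTop_atTop.comp (h2pow.comp hsub)).eventually_ge_atTop (16 / η)
  filter_upwards [hbad, hmean, hw, ht] with j hb hm hw1 ht1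
  -- the window length at `X = 2^j` is `h = 2^{⌊s j/2⌋}`
  have hsj := hs j
  have hh0 : min (2 ^ j) (2 ^ (s (Nat.log 2 (2 ^ j)) / 2)) = 2 ^ (s j / 2) := by
    rw [Nat.log_pow one_lt_two j]
    exact min_eq_right (Nat.pow_le_pow_right two_pos (by omega))
  rw [hh0] at hb
  simp only [Real.norm_eq_abs, Nat.abs_cast] at hb
  -- the deterministic core at `X = 2^j`, `H = 2^{s j}`, `h = 2^{⌊s j/2⌋}`, `M = 2^{j - s j}`
  have hXMH : 2 ^ j + 2 ^ (j - s j) * 2 ^ s j = 2 * 2 ^ j := by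
    rw [← pow_add, Nat.sub_add_cancel hsj]
    ring
  have hcore := alignedBlocks_core hAvg (fun n => (ArithmeticFunction.liouville n : ℝ))
    abs_liouville_le_one (2 ^ j) (2 ^ s j) (2 ^ (s j / 2)) (2 ^ (j - s j)) Nat.one_le_two_pow
    (Nat.pow_le_pow_right two_pos (Nat.div_le_self _ _))
    (Nat.pow_le_pow_right two_pos (by omega)) hXMH (η / 16)
    (((2 ^ j : ℕ) : ℝ)⁻¹ * ∑ n ∈ Ioc (2 ^ j) (2 * 2 ^ j), (ArithmeticFunction.liouville n : ℝ))
    hε.le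
  -- bookkeeping in `ℝ`
  have hhh : ((2 ^ (s j / 2) : ℕ) : ℝ) * ((2 ^ (s j / 2) : ℕ) : ℝ) ≤ ((2 ^ j : ℕ) : ℝ) := by
    have : 2 ^ (s j / 2) * 2 ^ (s j / 2) ≤ 2 ^ j := by
      rw [← pow_add]
      exact Nat.pow_le_pow_right two_pos (by omega)
    exact_mod_cast this
  have hprod : ((2 ^ (s j / 2) : ℕ) : ℝ) * ((2 ^ (j - s j) : ℕ) : ℝ)
      * ((2 ^ (s j - s j / 2) : ℕ) : ℝ) = ((2 ^ j : ℕ) : ℝ) := by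
    have : 2 ^ (s j / 2) * 2 ^ (j - s j) * 2 ^ (s j - s j / 2) = 2 ^ j := by
      rw [← pow_add, ← pow_add]
      congr 1
      omega
    exact_mod_cast this
  have hX1 : (1 : ℝ) ≤ ((2 ^ j : ℕ) : ℝ) := by exact_mod_cast Nat.one_le_two_pow
  have hhpos : (0 : ℝ) ≤ ((2 ^ (s j / 2) : ℕ) : ℝ) := Nat.cast_nonneg _
  have hMpos : (0 : ℝ) ≤ ((2 ^ (j - s j) : ℕ) : ℝ) := Nat.cast_nonneg _
  -- (1) `2h ≤ (η/8) X`
  have h16 : 16 ≤ ((2 ^ (s j / 2) : ℕ) : ℝ) * η := by rwa [div_le_iff₀ hη] at hw1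
  have p1a : 2 * ((2 ^ (s j / 2) : ℕ) : ℝ) * 16
      ≤ 2 * ((2 ^ (s j / 2) : ℕ) : ℝ) * (((2 ^ (s j / 2) : ℕ) : ℝ) * η) :=
    mul_le_mul_of_nonneg_left h16 (by positivity)
  have p1b : η * (((2 ^ (s j / 2) : ℕ) : ℝ) * ((2 ^ (s j / 2) : ℕ) : ℝ)) ≤ η * ((2 ^ j : ℕ) : ℝ) :=
    mul_le_mul_of_nonneg_left hhh hη.le
  -- (2) `2 (X+1) (ε + |A|) ≤ (η/2) X`
  have p2 : (((2 ^ j : ℕ) : ℝ) + 1) * (η / 16 + |((2 ^ j : ℕ) : ℝ)⁻¹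
      * ∑ n ∈ Ioc (2 ^ j) (2 * 2 ^ j), (ArithmeticFunction.liouville n : ℝ)|)
      ≤ (2 * ((2 ^ j : ℕ) : ℝ)) * (η / 8) :=
    mul_le_mul (by linarith) (by linarith [hm]) (by positivity) (by positivity)
  -- (4) `2 h M ≤ (η/8) X`
  have h16' : 16 ≤ ((2 ^ (s j - s j / 2) : ℕ) : ℝ) * η := by rwa [div_le_iff₀ hη] at ht1
  have p4a : ((2 ^ (s j / 2) : ℕ) : ℝ) * ((2 ^ (j - s j) : ℕ) : ℝ) * 16
      ≤ ((2 ^ (s j / 2) : ℕ) : ℝ) * ((2 ^ (j - s j) : ℕ) : ℝ)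
        * (((2 ^ (s j - s j / 2) : ℕ) : ℝ) * η) :=
    mul_le_mul_of_nonneg_left h16' (by positivity)
  have p4b : ((2 ^ (s j / 2) : ℕ) : ℝ) * ((2 ^ (j - s j) : ℕ) : ℝ)
        * (((2 ^ (s j - s j / 2) : ℕ) : ℝ) * η) = η * ((2 ^ j : ℕ) : ℝ) := by
    rw [← hprod]
    ring
  have hfin : ∑ i ∈ Finset.range (2 ^ (j - s j)),
      |∑ N ∈ Finset.Ico (2 ^ j + i * 2 ^ s j) (2 ^ j + (i + 1) * 2 ^ s j),
        (ArithmeticFunction.liouville N : ℝ)| ≤ η * ((2 ^ j : ℕ) : ℝ) := by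
    linarith [hcore, hb, p1a, p1b, p2, p4a, p4b, hX1]
  have hXr : ((2 ^ j : ℕ) : ℝ) = (2 : ℝ) ^ j := by push_cast; ring
  rw [hXr] at hfin
  exact hfin

end Summit.QuantumAdvantage.QuantumAdvantage.Theorems.LiouvilleOrthogonalTC0

end
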